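import Summits.ABC.IUTFork.Joshi.AdelicAnsatzPeriodBridge
import Summits.ABC.IUTFork.Joshi.AdelicAnsatzDerived
import HarnessLib

/-!
# [J-III] Thm. 4.6.1 (7) over T-07's actions — the "`Σ̃_{L′}` is preserved" half of `PeriodImageAction` DERIVED for
# `G_{L′}`, `ϕ^ℤ` and the diagonal `L′*`-action; the claim reduced to its DESCENT clause (block E, T-08 file 4 (part 1b))

Proof-only companion (abc-iut cell, block E, rung LADDER-ABC:A2.E; seat abc-iut-E-t8) of `Joshi/AdelicAnsatzPeriodBridge.lean`
(p431312: `ResidueFieldData.toArithPeriodDatum`, T-08's period carrier BUILT FROM T-07's `AdelicCurveDatum` with `ansatz :=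
adelicAnsatz`) and `Joshi/AdelicAnsatzPeriod.lean` (p429532: `ArithPeriodDatum.PeriodImageAction act` = [J-III]
arXiv:2401.13508v4 Thm. 4.6.1 (7), p.37 l.40–43: "`ℙ(Σ̃_{L′})` … is equipped with a natural action of all the groups and
symmetries … which act upon `Σ̃_{L′}`", typed as «`act` preserves `Σ̃_{L′}`» ∧ «`act` DESCENDS along the period map»), answering
the DERIVABLE row named by the T-07 author's typer-side read (abc-iut-E-t7, STATUS 08:09:15Z): for the three actions T-07
types on `(𝒴′_{L′})^{ℓ⋇}` ([J-III] Def. 4.2.1 (1)–(3); `AdelicCurveDatum.galTuple`, `frobTuple ^ n`, `lstarTupleDiag`) the FIRST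
clause of `PeriodImageAction` is T-07's Thm. 4.2.2.1 (1)–(3) AS DERIVED by T-07 from the [J-IIp]/[J-IIh] inputs it names
(`ansatzGaloisStable_of` ⇐ `PrimAnsatzGaloisStable` [J-IIp Prop. 6.7.1]; `mem_adelicAnsatz_iff_frobTuple_zpow_mem` ⇐
`PrimAnsatzFrobeniusInvariant` [J-IIp Prop. 6.6.1]; `ansatzLStarStableDiag_of` ⇐ `LStarThroughFrobenius` [J-IIh Thm. 4.2.3 (4)]
+ `PrimAnsatzFrobeniusInvariant`; files `Joshi/AdelicAnsatz.lean` p428940, `Joshi/AdelicAnsatzDerived.lean` p429123). Hence,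
over the reconciled carrier, Thm. 4.6.1 (7) for these actions REDUCES to its DESCENT clause `PeriodMapDescends act` — the
genuine content of (7) ("equipped with a natural [induced] action"), which stays a claim (it is [J-IIh] Thm. 5.10.1 (6)/(8):
how `H_y` moves to `H_{g·y}`). Kernel glue only; every Joshi input enters as a named hypothesis; TAKES NO SIDE on [IUTchIII]
Cor. 3.12 or on any author; typed ≠ proved. No `Cor312*`/`Thm311*` import (E-PLAN R14). Standard axioms; sorry-free.
-/

noncomputable section

open Set

namespace Summit.ABC.IUTFork.Joshi

namespace ArithPeriodDatum

variable {L : Type} [Field L] (P : ArithPeriodDatum L)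

/-- The DESCENT clause of [J-III] Thm. 4.6.1 (7) in isolation: equal period tuples stay equal after acting — what "the image
`ℙ(Σ̃_{L′})` is equipped with a natural [induced] action" requires of an action `act` on tuples ([J-IIh] Thm. 5.10.1 (6)
"moves `H_y` to `H_{x·y}`", (8)). Second conjunct of `PeriodImageAction`. HYPOTHESIS shape, never asserted.
[claim: Joshi2024ATS3, status: disputed] -/
def PeriodMapDescends {G : Type} (act : G → P.Tuple → P.Tuple) : Prop :=
  ∀ g : G, ∀ z ∈ P.ansatz, ∀ z' ∈ P.ansatz, P.periodMap z = P.periodMap z' → P.periodMap (act g z) = P.periodMap (act g z')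

/-- `PeriodImageAction` = preservation ∧ descent (definitional unfolding). [folklore] -/
theorem periodImageAction_iff {G : Type} (act : G → P.Tuple → P.Tuple) :
    P.PeriodImageAction act ↔ (∀ g : G, ∀ z ∈ P.ansatz, act g z ∈ P.ansatz) ∧ P.PeriodMapDescends act := Iff.rfl

/-- If `act` preserves `Σ̃_{L′}`, Thm. 4.6.1 (7) for `act` is exactly its descent clause. [folklore] -/
theorem periodImageAction_iff_descends {G : Type} {act : G → P.Tuple → P.Tuple}
    (hpres : ∀ g : G, ∀ z ∈ P.ansatz, act g z ∈ P.ansatz) : P.PeriodImageAction act ↔ P.PeriodMapDescends act :=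
  ⟨fun h => h.2, fun h => ⟨hpres, h⟩⟩

end ArithPeriodDatum

namespace AdelicCurveDatum

namespace ResidueFieldData

variable {D : AdelicCurveDatum} {L : Type} [Field L] (R : D.ResidueFieldData L)

/-! ### The three actions of [J-III] Def. 4.2.1 on the reconciled period carrier -/

/-- **`G_{L′}` (Def. 4.2.1 (1)) preserves `Σ̃_{L′}` — Thm. 4.2.2.1 (1) as DERIVED by T-07** (`ansatzGaloisStable_of` from the input
[J-IIp] Prop. 6.7.1 `PrimAnsatzGaloisStable`): the first clause of `PeriodImageAction (D.galTuple)` over the reconciled carrier.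
[folklore] -/
theorem galTuple_preserves (h : D.PrimAnsatzGaloisStable) :
    ∀ g : (w : D.V) → D.G w, ∀ z ∈ R.toArithPeriodDatum.ansatz, D.galTuple g z ∈ R.toArithPeriodDatum.ansatz :=
  fun g z hz => D.ansatzGaloisStable_of h g z hz

/-- **`ϕ^ℤ` (Def. 4.2.1 (2)) preserves `Σ̃_{L′}` — Thm. 4.2.2.1 (2) as DERIVED by T-07** (`mem_adelicAnsatz_iff_frobTuple_zpow_mem`
from the input [J-IIp] Prop. 6.6.1 `PrimAnsatzFrobeniusInvariant`), for the action `n ↦ frobTuple ^ n` of `ℤ`. [folklore] -/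
theorem frobTuple_zpow_preserves (h : D.PrimAnsatzFrobeniusInvariant) :
    ∀ n : ℤ, ∀ z ∈ R.toArithPeriodDatum.ansatz, (D.frobTuple ^ n) z ∈ R.toArithPeriodDatum.ansatz :=
  fun n z hz => (D.mem_adelicAnsatz_iff_frobTuple_zpow_mem h n z).1 hz

/-- **The diagonal `L′*`-action (Def. 4.2.1 (3), diagonal reading) preserves `Σ̃_{L′}` — Thm. 4.2.2.1 (3) as DERIVED by T-07**
(`ansatzLStarStableDiag_of` from [J-IIh] Thm. 4.2.3 (4) `LStarThroughFrobenius` + [J-IIp] Prop. 6.6.1). [folklore] -/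
theorem lstarTupleDiag_preserves (hF : D.LStarThroughFrobenius) (h : D.PrimAnsatzFrobeniusInvariant) :
    ∀ x : D.Lstar, ∀ z ∈ R.toArithPeriodDatum.ansatz, D.lstarTupleDiag x z ∈ R.toArithPeriodDatum.ansatz :=
  fun x z hz => D.ansatzLStarStableDiag_of hF h x z hz

/-! ### Thm. 4.6.1 (7) reduced to descent, action by action -/

/-- **Thm. 4.6.1 (7) for `G_{L′}`**, over the reconciled carrier and under [J-IIp] Prop. 6.7.1: `PeriodImageAction galTuple` ⟺ the
descent clause alone. [folklore] -/
theorem periodImageAction_galTuple_iff (h : D.PrimAnsatzGaloisStable) :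
    R.toArithPeriodDatum.PeriodImageAction D.galTuple ↔ R.toArithPeriodDatum.PeriodMapDescends D.galTuple :=
  R.toArithPeriodDatum.periodImageAction_iff_descends (R.galTuple_preserves h)

/-- **Thm. 4.6.1 (7) for `ϕ^ℤ`**, under [J-IIp] Prop. 6.6.1: `PeriodImageAction (n ↦ frobTuple ^ n)` ⟺ descent alone. [folklore] -/
theorem periodImageAction_frob_iff (h : D.PrimAnsatzFrobeniusInvariant) :
    R.toArithPeriodDatum.PeriodImageAction (fun n : ℤ => ⇑(D.frobTuple ^ n)) ↔
      R.toArithPeriodDatum.PeriodMapDescends (fun n : ℤ => ⇑(D.frobTuple ^ n)) :=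
  R.toArithPeriodDatum.periodImageAction_iff_descends (R.frobTuple_zpow_preserves h)

/-- **Thm. 4.6.1 (7) for the diagonal `L′*`-action**, under [J-IIh] Thm. 4.2.3 (4) + [J-IIp] Prop. 6.6.1:
`PeriodImageAction lstarTupleDiag` ⟺ descent alone. [folklore] -/
theorem periodImageAction_lstar_iff (hF : D.LStarThroughFrobenius) (h : D.PrimAnsatzFrobeniusInvariant) :
    R.toArithPeriodDatum.PeriodImageAction D.lstarTupleDiag ↔ R.toArithPeriodDatum.PeriodMapDescends D.lstarTupleDiag :=
  R.toArithPeriodDatum.periodImageAction_iff_descends (R.lstarTupleDiag_preserves hF h)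

end ResidueFieldData

end AdelicCurveDatum

end Summit.ABC.IUTFork.Joshi

end
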